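import Summits.Parity.GeneralizedHardyLittlewood.Theorems.LeeYangFibresRelativeDimOnePairRigidityDefs
import Literature.NumberTheory.Sieve.SieveFrameworkProofs
import HarnessLib

/-!
# Route `LeeYangFibres`, crux `RelativeDimOne` (stmt-Parity-14113), line `gallagher-backwards-split`:
# reshaped pair-slice rigidity — part 1, TOOLS

Seat c1 (`prover-line-stmt-Parity-14113-c1-0`) showed that the registered stub
`stub_rigidity : IncidenceRigidity (1/4) (3/10)` is FALSE (crux workfile
`Cruxes/RelativeDimOne/StubRigidityFalse-c1.md`: a product/Chebyshev adversary, and — inside the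
Hardy–Littlewood decay class — a second adversary exploiting the `(q/φ(q))^{t+1}` normalisation of the
progression data) and proposed the reshape under which rigidity survives: (i) HL-type COEFFICIENT
DECAY `|x_d| ≤ C/φ(d)` (squarefree support, level `Q`), (ii) PATTERN-RELATIVE progression data
`|Φ_q(r)| ≤ η · G(gcd(q,r))`, `G(n) = Σ_{d ∣ n} 1/φ(d)`.  The reshaped statement is proved in
`…PairRigidityDecay.lean` (part 3); this file carries the elementary tools over the vocabulary of `…PairRigidityDefs`
(`phiDivSum` = `G`, `divSum` = `F`, `densAvg` = `Φ`, `rphiDivSum`, `roughPrimorial`):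

* product formulas `G(Π S) = Π (1 + 1/(p−1))`, `R(Π S) = Π (1 + 1/(p(p−1)))` for sets of primes;
* the `w`-rough tail `Σ_{d ∣ Π_{w<p≤M} p, d ≠ 1} 1/(dφ(d)) ≤ e^{1/w} − 1 ≤ 2/w` (telescoping
  `Σ_{n>w} 1/(n(n−1)) = 1/w`).

Elementary; inputs: multiplicativity of `φ`, `Real.prod_one_add_le_exp_sum`, `Real.abs_exp_sub_one_le`.
-/

noncomputable section

open scoped BigOperators
open Finset Real

namespace Summit.Parity.GeneralizedHardyLittlewood.Cruxes.RelativeDimOne.RigidityC1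

/-! ### `G` : positivity, monotonicity, product formula on squarefree numbers -/

/-- Every term of `G` is nonnegative. -/
theorem phiDivSum_nonneg (n : ℕ) : 0 ≤ phiDivSum n :=
  Finset.sum_nonneg fun d _ => by positivity

/-- `G` is monotone along divisibility. -/
theorem phiDivSum_mono {m n : ℕ} (hmn : m ∣ n) (hn : n ≠ 0) : phiDivSum m ≤ phiDivSum n := by
  unfold phiDivSum
  exact Finset.sum_le_sum_of_subset_of_nonneg (Nat.divisors_subset_of_dvd hn hmn)
    fun d _ _ => by positivity

/-- `1 ≤ G(n)` for `n ≠ 0` (the divisor `d = 1`). -/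
theorem one_le_phiDivSum {n : ℕ} (hn : n ≠ 0) : 1 ≤ phiDivSum n := by
  have h1 : phiDivSum 1 ≤ phiDivSum n := phiDivSum_mono (one_dvd n) hn
  rwa [phiDivSum_one] at h1

/-- Product formula: for a finite set `S` of primes, `G(Π S) = Π_{p ∈ S} (1 + 1/(p−1))`. -/
theorem phiDivSum_prod_primes (S : Finset ℕ) (hS : ∀ p ∈ S, p.Prime) :
    phiDivSum (∏ p ∈ S, p) = ∏ p ∈ S, (1 + 1 / ((p : ℝ) - 1)) := by
  classical
  induction S using Finset.induction_on with
  | empty => simp [phiDivSum]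
  | insert p S hpS ih =>
    have hp : p.Prime := hS p (Finset.mem_insert_self p S)
    have hS' : ∀ q ∈ S, q.Prime := fun q hq => hS q (Finset.mem_insert_of_mem hq)
    rw [Finset.prod_insert hpS, Finset.prod_insert hpS]
    have hcop : Nat.Coprime p (∏ q ∈ S, q) := by
      refine Nat.Coprime.prod_right fun q hq => ?_
      have hq' : q.Prime := hS' q hq
      have hne : p ≠ q := fun h => hpS (h ▸ hq)
      exact (Nat.coprime_primes hp hq').mpr hne
    unfold phiDivSum
    rw [Literature.NumberTheory.Sieve.sum_divisors_mul_of_coprime hcop]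
    rw [hp.divisors]
    have h1p : (1 : ℕ) ≠ p := hp.one_lt.ne
    rw [Finset.sum_pair h1p]
    simp only [one_mul]
    have ih' := ih hS'
    unfold phiDivSum at ih'
    rw [ih']
    have hsum : ∑ b ∈ (∏ q ∈ S, q).divisors, (1 : ℝ) / (Nat.totient (p * b)) =
        (1 / ((p : ℝ) - 1)) * ∑ b ∈ (∏ q ∈ S, q).divisors, (1 : ℝ) / (Nat.totient b) := by
      rw [Finset.mul_sum]
      refine Finset.sum_congr rfl fun b hb => ?_
      have hbdvd : b ∣ ∏ q ∈ S, q := Nat.dvd_of_mem_divisors hb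
      have hcopb : Nat.Coprime p b := hcop.coprime_dvd_right hbdvd
      rw [Nat.totient_mul hcopb, Nat.totient_prime hp, Nat.cast_mul]
      have hp1 : ((p - 1 : ℕ) : ℝ) = (p : ℝ) - 1 := by
        rw [Nat.cast_sub hp.one_lt.le, Nat.cast_one]
      rw [hp1]
      rw [one_div_mul_one_div]
    rw [hsum, ih']
    ring

/-! ### Totient of squarefree products -/

/-- `φ(a b) = φ(a) φ(b)` as reals for coprime `a, b`. -/
theorem totient_mul_cast {a b : ℕ} (h : Nat.Coprime a b) :
    (Nat.totient (a * b) : ℝ) = Nat.totient a * Nat.totient b := by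
  rw [Nat.totient_mul h, Nat.cast_mul]

/-! ### The weight `1/(d φ(d))` and the `w₀`-rough tail -/

/-- Product formula: for a finite set `S` of primes, `R(Π S) = Π_{p ∈ S} (1 + 1/(p(p−1)))`. -/
theorem rphiDivSum_prod_primes (S : Finset ℕ) (hS : ∀ p ∈ S, p.Prime) :
    rphiDivSum (∏ p ∈ S, p) = ∏ p ∈ S, (1 + 1 / ((p : ℝ) * ((p : ℝ) - 1))) := by
  classical
  induction S using Finset.induction_on with
  | empty => simp [rphiDivSum]
  | insert p S hpS ih =>
    have hp : p.Prime := hS p (Finset.mem_insert_self p S)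
    have hS' : ∀ q ∈ S, q.Prime := fun q hq => hS q (Finset.mem_insert_of_mem hq)
    rw [Finset.prod_insert hpS, Finset.prod_insert hpS]
    have hcop : Nat.Coprime p (∏ q ∈ S, q) := by
      refine Nat.Coprime.prod_right fun q hq => ?_
      have hq' : q.Prime := hS' q hq
      have hne : p ≠ q := fun h => hpS (h ▸ hq)
      exact (Nat.coprime_primes hp hq').mpr hne
    unfold rphiDivSum
    rw [Literature.NumberTheory.Sieve.sum_divisors_mul_of_coprime hcop]
    rw [hp.divisors]
    have h1p : (1 : ℕ) ≠ p := hp.one_lt.ne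
    rw [Finset.sum_pair h1p]
    simp only [one_mul]
    have ih' := ih hS'
    unfold rphiDivSum at ih'
    rw [ih']
    have hsum : ∑ b ∈ (∏ q ∈ S, q).divisors, (1 : ℝ) / (((p * b : ℕ) : ℝ) * Nat.totient (p * b)) =
        (1 / ((p : ℝ) * ((p : ℝ) - 1))) *
          ∑ b ∈ (∏ q ∈ S, q).divisors, (1 : ℝ) / ((b : ℝ) * Nat.totient b) := by
      rw [Finset.mul_sum]
      refine Finset.sum_congr rfl fun b hb => ?_
      have hbdvd : b ∣ ∏ q ∈ S, q := Nat.dvd_of_mem_divisors hb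
      have hcopb : Nat.Coprime p b := hcop.coprime_dvd_right hbdvd
      rw [Nat.totient_mul hcopb, Nat.totient_prime hp, Nat.cast_mul, Nat.cast_mul]
      have hp1 : ((p - 1 : ℕ) : ℝ) = (p : ℝ) - 1 := by
        rw [Nat.cast_sub hp.one_lt.le, Nat.cast_one]
      rw [hp1, one_div_mul_one_div]
      congr 1
      ring
    rw [hsum, ih']
    ring

/-- Telescoping: `Σ_{w < n ≤ M} 1/(n(n−1)) ≤ 1/w` for `1 ≤ w`. -/
theorem sum_Ioc_inv_mul_pred_le {w : ℕ} (hw : 1 ≤ w) (M : ℕ) :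
    ∑ n ∈ Ioc w M, (1 : ℝ) / ((n : ℝ) * ((n : ℝ) - 1)) ≤ 1 / w := by
  -- `Σ_{w < n ≤ M} 1/(n(n-1)) = 1/w - 1/max(w,M)`
  have key : ∀ M : ℕ, w ≤ M →
      ∑ n ∈ Ioc w M, (1 : ℝ) / ((n : ℝ) * ((n : ℝ) - 1)) = 1 / w - 1 / M := by
    intro M hM
    induction M, hM using Nat.le_induction with
    | base => simp
    | succ M hwM ih =>
      rw [Finset.sum_Ioc_succ_top (by omega), ih]
      have hM0 : (0 : ℝ) < M := by exact_mod_cast (lt_of_lt_of_le hw hwM)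
      have hMne : (M : ℝ) ≠ 0 := hM0.ne'
      have hM1ne : (M : ℝ) + 1 ≠ 0 := by positivity
      have hM1 : ((M + 1 : ℕ) : ℝ) = (M : ℝ) + 1 := by push_cast; ring
      rw [hM1]
      have e : (1 : ℝ) / (((M : ℝ) + 1) * ((M : ℝ) + 1 - 1)) = 1 / M - 1 / ((M : ℝ) + 1) := by
        rw [add_sub_cancel_right, div_sub_div _ _ hMne hM1ne]
        congr 1 <;> ring
      rw [e]
      ring
  by_cases hM : w ≤ M
  · rw [key M hM]
    have : (0 : ℝ) ≤ 1 / M := by positivity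
    linarith
  · push Not at hM
    rw [Finset.Ioc_eq_empty (by omega), Finset.sum_empty]
    positivity

/-- The rough primorial is positive. -/
theorem roughPrimorial_pos (w M : ℕ) : 0 < roughPrimorial w M :=
  Finset.prod_pos fun _ hp => (Finset.mem_filter.1 hp).2.pos

/-- `R(Π_{w < p ≤ M} p) ≤ exp(1/w)`. -/
theorem rphiDivSum_roughPrimorial_le {w : ℕ} (hw : 1 ≤ w) (M : ℕ) :
    rphiDivSum (roughPrimorial w M) ≤ Real.exp (1 / w) := by
  unfold roughPrimorial
  rw [rphiDivSum_prod_primes _ (fun p hp => (Finset.mem_filter.1 hp).2)]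
  have hnn : ∀ p ∈ (Ioc w M).filter Nat.Prime, (0 : ℝ) ≤ 1 / ((p : ℝ) * ((p : ℝ) - 1)) := by
    intro p hp
    have hp2 : (2 : ℝ) ≤ p := by exact_mod_cast (Finset.mem_filter.1 hp).2.two_le
    have : (0 : ℝ) < (p : ℝ) * ((p : ℝ) - 1) := by nlinarith
    positivity
  refine (Real.prod_one_add_le_exp_sum _ ?_).trans ?_
  · intro p
    by_cases hp : p ∈ (Ioc w M).filter Nat.Prime
    · exact hnn p hp
    · -- the lemma asks nonnegativity for all indices; outside the set use the same formula
      by_cases h2 : (2 : ℝ) ≤ p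
      · have : (0 : ℝ) < (p : ℝ) * ((p : ℝ) - 1) := by nlinarith
        positivity
      · push Not at h2
        -- p ∈ {0,1}: the expression is `1/0` or `1/(1*0)`, i.e. `0` in Lean
        have hp01 : p = 0 ∨ p = 1 := by
          have : (p : ℝ) < 2 := h2
          have : p < 2 := by exact_mod_cast this
          omega
        rcases hp01 with rfl | rfl <;> simp
  · refine Real.exp_le_exp.mpr ?_
    calc ∑ p ∈ (Ioc w M).filter Nat.Prime, (1 : ℝ) / ((p : ℝ) * ((p : ℝ) - 1))
        ≤ ∑ n ∈ Ioc w M, (1 : ℝ) / ((n : ℝ) * ((n : ℝ) - 1)) := by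
          refine Finset.sum_le_sum_of_subset_of_nonneg (Finset.filter_subset _ _) ?_
          intro n hn _
          have hn1 : (1 : ℝ) + 1 ≤ n := by
            have : w + 1 ≤ n := (Finset.mem_Ioc.1 hn).1
            have : 2 ≤ n := by omega
            exact_mod_cast this
          have : (0 : ℝ) < (n : ℝ) * ((n : ℝ) - 1) := by nlinarith
          positivity
      _ ≤ 1 / w := sum_Ioc_inv_mul_pred_le hw M

/-- The `w`-rough tail: over the divisors `d ≠ 1` of `Π_{w < p ≤ M} p`,
`Σ 1/(d φ(d)) ≤ exp(1/w) − 1 ≤ 2/w`. -/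
theorem sum_rough_divisors_le {w : ℕ} (hw : 1 ≤ w) (M : ℕ) :
    ∑ d ∈ (roughPrimorial w M).divisors.erase 1, (1 : ℝ) / ((d : ℝ) * Nat.totient d) ≤ 2 / w := by
  have h1 : (1 : ℕ) ∈ (roughPrimorial w M).divisors :=
    Nat.one_mem_divisors.2 (roughPrimorial_pos w M).ne'
  have hsplit := Finset.sum_erase_add (roughPrimorial w M).divisors
    (fun d => (1 : ℝ) / ((d : ℝ) * Nat.totient d)) h1
  have htot : ∑ d ∈ (roughPrimorial w M).divisors, (1 : ℝ) / ((d : ℝ) * Nat.totient d) ≤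
      Real.exp (1 / w) := rphiDivSum_roughPrimorial_le hw M
  simp only [Nat.cast_one, Nat.totient_one, mul_one, div_one] at hsplit
  have hexp : Real.exp (1 / (w : ℝ)) - 1 ≤ 2 / w := by
    have hw1 : |(1 : ℝ) / w| ≤ 1 := by
      rw [abs_of_nonneg (by positivity)]
      have : (1 : ℝ) ≤ w := by exact_mod_cast hw
      exact (div_le_one (by positivity)).mpr this
    have h1 := Real.abs_exp_sub_one_le hw1
    have h2 : Real.exp (1 / (w : ℝ)) - 1 ≤ |Real.exp (1 / (w : ℝ)) - 1| := le_abs_self _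
    rw [abs_of_nonneg (show (0 : ℝ) ≤ 1 / w by positivity)] at h1
    have h3 : (2 : ℝ) * (1 / w) = 2 / w := by ring
    linarith
  linarith


/-- Registered hook (stmt-Parity-14113, seat c1): the `w`-rough tail bound, `∀`-form of
`sum_rough_divisors_le`. -/
theorem roughTailHook : ∀ (w M : ℕ), 1 ≤ w →
    ∑ d ∈ (roughPrimorial w M).divisors.erase 1, (1 : ℝ) / ((d : ℝ) * Nat.totient d) ≤ 2 / w :=
  fun _ M hw => sum_rough_divisors_le hw M

end Summit.Parity.GeneralizedHardyLittlewood.Cruxes.RelativeDimOne.RigidityC1
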